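import Summits.BirchSwinnertonDyer.Rank1Residual.X2.GreenbergVatsalTateDatumCofree
import Summits.BirchSwinnertonDyer.Rank1Residual.X2.NonPrimitiveSelmerCorank
import Literature.NumberTheory.EllipticCurves.GreenbergVatsal2000.DatumSelmerDivisible
import Literature.NumberTheory.EllipticCurves.ZpCorankQuasiIso
import HarnessLib

/-!
# `#(S^{Σ₀}_{E[p^∞]}(ℚ_∞) ⊓ H¹[p]) = p^{λ(E) + Σ_{ℓ∈Σ₀} δ_E^{(ℓ)}}` at an odd NON-SPLIT multiplicative
# prime `p ‖ N` (`e_p = 0`) — the `p ‖ N` member of route G, from printed GV statements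

HONEST FRAMING (cell `b2b-bsdres`, run/shared/lean/b2b/bsd-rank1-residual/, verbatim in every
file): the goal of the cell is to DELETE the COMBINATION-SHAPED residual classes of the
Birch–Swinnerton-Dyer formula for ALL analytic-rank `≤ 1` elliptic curves over `ℚ` — "full BSD
formula for every rank `≤ 1` curve in class `C`" assembled STRICTLY from published theorems — so
that the rank-`≤ 1` remainder becomes exactly the CONSTRUCTION-SHAPED classes, which are TYPED
(missing-input `Prop`s), NOT attempted. This is not "finishing BSD". Sub-cell
`b2b-bsdres-eisenstein-p2` (CLASS-OWNERS row "X2"), gen 13: research route; NO CLAIM BEYOND STATED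
CLASSES; nothing here changes a label. Theorems only; axioms standard; no `sorry`.

WHAT THIS FILE PROVES (step K-B2 of the `p ‖ N` Λ-bookkeeping for route G; X2-GAP §12, §16.6,
§17.4; the gen-11 theorem `CongruentLambdaShiftDerived.natCard_gvSelmerInfty_inf_torsionBy_eq_pow`
at a good ordinary prime, now at a NON-SPLIT multiplicative prime).
For `E/ℚ` globally minimal, `p` ODD with `p ‖ N` NON-split, `κ` cyclotomic with topological
generator `γ`, `Σ₀ ∌ p` finite with every `v ∉ Σ₀ ∪ {p}` good, and `μ(E) = 0` (any f.g. torsion dual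
datum `D` of `Sel_{p^∞}(E/ℚ_∞)` with `D.mu = 0`):
**`exists_data_natCard_gvSelmerInfty_inf_torsion_eq_pow_of_not_split`** — for the Tate data `L`
above `p` (with GV's `htriv`, `hgen`): `#(S^{Σ₀}_{E[p^∞]}(ℚ_∞) ⊓ H¹(ℚ_∞, E[p^∞])[p]) = p^{λ(D.X) + Σ_{v∈Σ₀} δ_E^{(v)}}`.
Chain: `Sel^{Σ₀}_E(ℚ_∞)_p = S^{Σ₀,str} = S^{Σ₀}` (gen 12, no trivial zero at a non-split prime;
kernel, only A41); `corank_{ℤ_p} Sel^{Σ₀} = λ + Σδ` and `Sel^{Σ₀}[p]` finite (gen 13 K-A, from GV (5)–(7)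
at `p ‖ N` = fact `lambda_nonPrimitive_eq_add_sum_delta_multiplicative`); `S^{Σ₀}` divisible (GV
Prop. (2.5)/p. 25 = fact `datumSelmer_divisible_of_finite_torsionBy`, its datum hypotheses discharged
by `GreenbergVatsalTateDatumCofree`); `#S[p] = p^{corank S}·#(S/pS)` (tree
`pow_zpCorank_mul_natCard_modN`) with `S/pS = 0`.
Inputs that are NOT tree theorems: A41 (Tate uniformisation, `hT`), GV (5)–(7) at `p ‖ N` (`hA`),
GV Prop. (2.5)/p. 25 (`hB`); Kato's cotorsion enters as the hypothesis `D.IsTorsion`.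

References: Greenberg–Vatsal 2000 §1 (5)–(7), §2 pp. 14–16, Prop. (2.5), p. 25; Greenberg LNM 1716
Lemma 4.6; Silverman *ATAEC* V.5.
-/

noncomputable section

open scoped Classical AddSubgroup

universe u

namespace Summit.BirchSwinnertonDyer.Rank1Residual.X2.GreenbergSelmerCountNonsplit

open NumberField IsDedekindDomain Field Literature.NumberTheory.GaloisRepresentations
  Literature.NumberTheory.EllipticCurves Literature.NumberTheory.EllipticCurves.GreenbergSelmer
  Literature.NumberTheory.EllipticCurves.GreenbergVatsal2000
  Summit.BirchSwinnertonDyer.Rank1Residual.X2.GreenbergVatsalTorsion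
  Summit.BirchSwinnertonDyer.Rank1Residual.X2.GreenbergVatsalStrictSelmer
  Summit.BirchSwinnertonDyer.Rank1Residual.X2.NonPrimitiveSelmerStrictEquality
  Summit.BirchSwinnertonDyer.Rank1Residual.X2.GreenbergVatsalTateDatumCofree
  Summit.BirchSwinnertonDyer.Rank1Residual.X2.NonPrimitiveSelmerCorank
  Summit.BirchSwinnertonDyer.Rank1Residual.X2.NonPrimitiveSelmerTorsionCard

/-! ## §1. Algebra: `p`-torsion of a subgroup; `#S[p] = p^{corank}` for divisible `S` -/

section Algebra

variable {G : Type*} [AddCommGroup G]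

/-- `(↥T)[n] ≃ ↥(T ⊓ G[n])` for an additive subgroup `T ≤ G` (as a `Nonempty`, to keep this file
theorems-only). [folklore] -/
theorem nonempty_torsionByEquivInf (T : AddSubgroup G) (n : ℤ) :
    Nonempty (↥((↥T)[n]) ≃ ↥(T ⊓ G[n])) :=
  ⟨{ toFun := fun x ↦ ⟨((x : T) : G), AddSubgroup.mem_inf.2 ⟨(x : T).2, by
        have hx : n • (x : T) = 0 := mem_torsionBy_iff.1 x.2
        rw [mem_torsionBy_iff, ← AddSubgroupClass.coe_zsmul, hx, ZeroMemClass.coe_zero]⟩⟩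
     invFun := fun y ↦ ⟨⟨(y : G), (AddSubgroup.mem_inf.1 y.2).1⟩, by
        rw [mem_torsionBy_iff]
        apply Subtype.ext
        rw [AddSubgroupClass.coe_zsmul, ZeroMemClass.coe_zero]
        exact mem_torsionBy_iff.1 (AddSubgroup.mem_inf.1 y.2).2⟩
     left_inv := fun x ↦ by ext; rfl
     right_inv := fun y ↦ by ext; rfl }⟩

/-- `#(T ⊓ G[n]) = #(↥T)[n]`. [folklore] -/
theorem natCard_inf_torsionBy_eq (T : AddSubgroup G) (n : ℤ) :
    Nat.card ↥(T ⊓ G[n]) = Nat.card ↥((↥T)[n]) :=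
  (Nat.card_congr (nonempty_torsionByEquivInf T n).some).symm

/-- `T ⊓ G[n]` is finite iff `(↥T)[n]` is. [folklore] -/
theorem finite_inf_torsionBy_iff (T : AddSubgroup G) (n : ℤ) :
    Finite ↥(T ⊓ G[n]) ↔ Finite ↥((↥T)[n]) :=
  ⟨fun _ ↦ Finite.of_equiv _ (nonempty_torsionByEquivInf T n).some.symm,
    fun _ ↦ Finite.of_equiv _ (nonempty_torsionByEquivInf T n).some⟩

/-- Membership transfer: `x ∈ (↥T)[n]` gives `(x : G) ∈ G[n]`. [folklore] -/
theorem coe_mem_torsionBy_of_mem {T : AddSubgroup G} {n : ℤ} (x : ↥((↥T)[n])) :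
    ((x : T) : G) ∈ G[n] := by
  have hx : n • (x : T) = 0 := mem_torsionBy_iff.1 x.2
  rw [mem_torsionBy_iff, ← AddSubgroupClass.coe_zsmul, hx, ZeroMemClass.coe_zero]

variable (p : ℕ) [hp : Fact p.Prime] {S : Type*} [AddCommGroup S]

/-- **`#S[p] = p ^ corank_{ℤ_p} S` for a `p`-primary, `p`-DIVISIBLE group with `S[p]` finite**
(`#S[p] = p^{corank}·#(S/pS)`, tree `pow_zpCorank_mul_natCard_modN`, and `S/pS = 0`).
[folklore] -/
theorem natCard_torsionBy_eq_pow_zpCorank_of_divisible (hS : ∀ s : S, ∃ n : ℕ, p ^ n • s = 0)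
    [Finite (S[(p : ℤ)])] (hdiv : ∀ s : S, ∃ t : S, p • t = s) :
    Nat.card (S[(p : ℤ)]) = p ^ zpCorank S p := by
  have h := pow_zpCorank_mul_natCard_modN (p := p) hS
  haveI : Subsingleton (ModN S p) :=
    ⟨fun a b ↦ by rw [modN_eq_zero_of_divisible p hdiv a, modN_eq_zero_of_divisible p hdiv b]⟩
  rw [Nat.card_of_subsingleton (0 : ModN S p), mul_one] at h
  exact h.symm

end Algebra

/-! ## §2. The non-split count -/

section Nonsplit

variable (W : WeierstrassCurve ℚ) [W.IsGloballyMinimal] [W.IsElliptic] (p : ℕ) [hp : Fact p.Prime]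
  (κ : ZpExtension ℚ p) {γ : absoluteGaloisGroup ℚ} (S₀ : Finset (HeightOneSpectrum (𝓞 ℚ)))

/-- **`#(S^{Σ₀}_{E[p^∞]}(ℚ_∞) ⊓ H¹[p]) = p^{λ(E) + Σ_{v∈Σ₀} δ_E^{(v)}}` at an odd NON-SPLIT `p ‖ N`**
(`E/ℚ` globally minimal, `κ` cyclotomic with topological generator `γ`, `Σ₀ ∌ p` finite with every
`v ∉ Σ₀ ∪ {p}` good, `D` a f.g. `Λ`-torsion dual datum of `Sel_{p^∞}(E/ℚ_∞)` with `μ = 0`), for the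
Tate data `L` above `p` — which carries GV's `htriv` and `hgen`, so that `L` is admissible for the
kernel transfer `GreenbergVatsalTorsionInvariants.natCard_gvSelmer_inf_torsion_eq_of_inertia`.
Inputs: A41 (`hT`), GV (5)–(7) at `p ‖ N` (`hA`), GV Prop. (2.5)/p. 25 (`hB`). No trivial zero at a
non-split prime: `e_p = 0` (GV p. 15 "the arguments … go through almost unchanged").
[cite: GreenbergVatsal2000, §1 (5)–(7) pp. 7–8; §2 pp. 14–16, Prop. (2.5), p. 25]
[cite: SilvermanATAEC1994, Ch. V Lemma 5.2 (c), Thm. 5.3 (a),(b), Cor. 5.4 (held copy PDF pp. 406–410)] -/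
theorem exists_data_natCard_gvSelmerInfty_inf_torsion_eq_pow_of_not_split
    (hT : Silverman1994_thmV53_corV54_tateUniformisation.{0})
    (hA : lambda_nonPrimitive_eq_add_sum_delta_multiplicative)
    (hB : datumSelmer_divisible_of_finite_torsionBy)
    (hκ : κ.IsCyclotomic) (hγ : κ.IsTopGenerator γ) (hp2 : p ≠ 2)
    (hmult : W.HasMultiplicativeReductionAtPrime p) (hns : ¬ W.HasSplitMultiplicativeReductionAtPrime p)
    (hS₀ : ∀ v ∈ S₀, ((p : ℕ) : 𝓞 ℚ) ∉ v.asIdeal)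
    (hS : ∀ v : HeightOneSpectrum (𝓞 ℚ), v ∉ S₀ → ((p : ℕ) : 𝓞 ℚ) ∉ v.asIdeal →
      W.HasGoodReductionAt v)
    (D : W.SelmerDualData κ γ) [Module.Finite (IwasawaAlgebra p) D.X] (hX : D.IsTorsion)
    (hμ : D.mu = 0) :
    ∃ L : Data ℚ (W.geomPrimaryTorsion p) p,
      (∀ (v : HeightOneSpectrum (𝓞 ℚ)) (hv : ((p : ℕ) : 𝓞 ℚ) ∈ v.asIdeal),
        ∀ x ∈ inertia v, ∀ m : W.geomPrimaryTorsion p, x • m - m ∈ (L v hv).plus) ∧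
      (∀ (v : HeightOneSpectrum (𝓞 ℚ)) (hv : ((p : ℕ) : 𝓞 ℚ) ∈ v.asIdeal),
        ∀ c ∈ (torsionData L p v hv).plus, ∃ τ ∈ inertia v,
          ∃ c' ∈ (torsionData L p v hv).plus, τ • c' - c' = c) ∧
      nonPrimitiveSelmerInfty W κ (↑S₀ : Set (HeightOneSpectrum (𝓞 ℚ))) =
        gvSelmerInfty κ (W.geomPrimaryTorsion p) L (↑S₀ : Set (HeightOneSpectrum (𝓞 ℚ))) ∧
      Nat.card ↥(gvSelmerInfty κ (W.geomPrimaryTorsion p) L (↑S₀ : Set (HeightOneSpectrum (𝓞 ℚ))) ⊓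
          (subgroupH1 κ.kerSubgroup (W.geomPrimaryTorsion p))[(p : ℤ)]) =
        p ^ (lambdaInvariant p D.X + ∑ v ∈ S₀, delta W p v) := by
  obtain ⟨L, htriv, hgen, hC, heqK, hle, hge⟩ :=
    exists_data_of_not_split W p κ hT hκ hp2 hmult hns
  set S₀' : Set (HeightOneSpectrum (𝓞 ℚ)) := ↑S₀ with hS₀'
  have hS₀'' : ∀ v ∈ S₀', ((p : ℕ) : 𝓞 ℚ) ∉ v.asIdeal := fun v hv ↦ hS₀ v (Finset.mem_coe.1 hv)
  have hS' : ∀ v : HeightOneSpectrum (𝓞 ℚ), v ∉ S₀' → ((p : ℕ) : 𝓞 ℚ) ∉ v.asIdeal →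
      W.HasGoodReductionAt v := fun v hv hpv ↦ hS v (fun h ↦ hv (Finset.mem_coe.2 h)) hpv
  -- `Sel^{Σ₀} = S^{Σ₀,str} = S^{Σ₀}`
  have heq₁ : nonPrimitiveSelmerInfty W κ S₀' =
      gvStrictSelmerInfty κ (W.geomPrimaryTorsion p) L S₀' :=
    nonPrimitiveSelmerInfty_eq_gvStrictSelmerInfty_of_le W p κ L S₀' hp2 hκ hS₀'' hS' hle hge
  have heq₂ : gvStrictSelmerInfty κ (W.geomPrimaryTorsion p) L S₀' =
      gvSelmerInfty κ (W.geomPrimaryTorsion p) L S₀' :=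
    gvStrictSelmerInfty_eq_gvSelmerInfty_of_forall_eq κ (W.geomPrimaryTorsion p) L S₀' heqK
  have heq : nonPrimitiveSelmerInfty W κ S₀' = gvSelmerInfty κ (W.geomPrimaryTorsion p) L S₀' :=
    heq₁.trans heq₂
  -- corank and finiteness of `Sel^{Σ₀}[p]` (GV (7) at `p ‖ N`)
  obtain ⟨hfin, hcork⟩ :=
    finite_torsionBy_and_zpCorank_nonPrimitiveSelmerInfty_eq_multiplicative W S₀ hA hp2 hmult hκ hγ
      hS₀ D hX hμ
  haveI := hfin
  -- finiteness of `S^{Σ₀} ⊓ H¹[p]`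
  haveI hfinS : Finite ↥(gvSelmerInfty κ (W.geomPrimaryTorsion p) L S₀' ⊓
      (subgroupH1 κ.kerSubgroup (W.geomPrimaryTorsion p))[(p : ℤ)]) := by
    rw [← heq, finite_inf_torsionBy_iff]; exact hfin
  -- divisibility of `S^{Σ₀}` (GV Prop. (2.5) / p. 25)
  have hdiv : ∀ s : nonPrimitiveSelmerInfty W κ S₀', ∃ t : nonPrimitiveSelmerInfty W κ S₀',
      p • t = s := by
    intro s
    have hs : (s : W.subgroupH1 p κ.kerSubgroup) ∈
        datumSelmerInfty κ (W.geomPrimaryTorsion p) L S₀' := by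
      rw [← gvSelmerInfty_eq_datumSelmerInfty, ← heq]; exact s.2
    obtain ⟨t, ht, hts⟩ := hB W p hp2 κ hκ L hC htriv S₀ hS₀ hS hfinS (s : W.subgroupH1 p κ.kerSubgroup)
      hs
    have ht' : t ∈ nonPrimitiveSelmerInfty W κ S₀' := by
      rw [heq]; exact ht
    exact ⟨⟨t, ht'⟩, Subtype.ext (by rw [AddSubgroupClass.coe_nsmul]; exact hts)⟩
  refine ⟨L, htriv, hgen, heq, ?_⟩
  rw [← heq, natCard_inf_torsionBy_eq, ← hcork]
  exact natCard_torsionBy_eq_pow_zpCorank_of_divisible p (isPrimary_nonPrimitiveSelmerInfty W S₀) hdiv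

end Nonsplit

end Summit.BirchSwinnertonDyer.Rank1Residual.X2.GreenbergSelmerCountNonsplit

end
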